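import Mathlib
import Literature.MathematicalPhysics.QuantumFieldTheory.Balaban1983to89.Beta.DeltaACombesThomas

/-!
# `Summit.QuantumFields.BalabanUV.Beta.AccretiveCombesThomas` — the finite Combes–Thomas bound for
# ACCRETIVE (non-Hermitian, `Re`-coercive) complex kernels: conjugated form, defect-budget algebra
# (positive parts cost ONLY their defect — monotone majorant), the pairing bound, invertibility,
# and the entrywise localisation of the inverse

HONEST FRAMING (page 1 of everything in this cell).  Discharging `FlowStep.BetaPertH` would make
Bałaban's ultraviolet stability UNCONDITIONAL — a constructive-QFT result; it is NOT the continuum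
limit and NOT the Clay problem.  This module discharges nothing of `BetaPertH`; it is ELEMENTARY
finite-dimensional linear algebra ([folklore]: Combes–Thomas 1973 ∕ Agmon), kernel-checked, written for
the β sub-cell's binder row D4 (unit `b2b-balaban-beta-d4-p3`, road P3 «reduction road», gen 3) as the
first kernel leaf of the road's re-cut of the residual's apex NODE A = (T1)(i)(ii) ⇐ (T2) G-IF-10 ⇐ (T3)
G-B9-10 of the owner's census `BETA/REMAINDER-BETA.md` §9: *analyticity in the complexified background
and ONE localisation majorant UNIFORM on the complex domain* for the propagators of [II] (2.14)–(2.17).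
HONEST DEPENDENCY: continuum YM on T⁴ ⇐ BetaPertH ∧ nine spine estimates (0/9 proved); BetaPertH ⇐
(D1) ∧ (D4) ∧ CAP+tail; G-an2-4 gates asym, D1 and NE2/3/4.

WHY THIS FILE.  The tree's Combes–Thomas modules are REAL (`Beta.CombesThomasForm`,
`Beta.CombesThomasFormOp`, `B9SectEKernel.resolvent_decay_uniform`, `QGQInverse.inverse_decay`) or
complex-HERMITIAN (`Beta.DeltaACombesThomas.combesThomas_pairwise`, hypothesis `A.IsHermitian`).  On the
complexified small-field domain `(𝐔, 𝐉) ∈ 𝐔ᶜ_{k+1}(X, α₀, α₁)` of [I] = B12 (CMP 109) (1.17)–(1.18) the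
local operators whose inverses are the propagators of [II] = B13 (CMP 116) §2 are NO LONGER HERMITIAN:
only their real (Hermitian) part is coercive, and the anti-Hermitian part — one power of the lattice
spacing better than the Laplacian's `η⁻²` coefficients, because the complex deviation of a link variable
on that domain is `O(η)` — has a conjugation defect of FIRST order in the weight.  `CombesThomasForm`'s
docstring records the perturbed ∕ non-local members as «not in this file».  This module supplies the
accretive mechanism, abstract over a finite index set; the sibling `AccretiveCombesThomasBudget` supplies
the defect bounds (Hermitian cosh budget, Schur budget of an arbitrary remainder, range ∕ exponential
localisation), and `AccretiveCombesThomasAnalytic` the analytic-family layer with the (2.16)-shape END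
through `B13PerturbativeStep.WRS.sub_apply_zero_of_differentiableOn` BY NAME.
* §1 the conjugated sesquilinear form `conjForm A κ ρ z = Σ z̄_e e^{κ(ρ_e − ρ_{e′})} A(e,e′) z_{e′}`, its
  additivity ∕ homogeneity ∕ shift-invariance ∕ value at weighted vectors; the three hypothesis SHAPES used
  throughout (no `Prop`-valued definitions): `Re`-coercivity `γ‖z‖² ≤ Re z^*Az`, conjugation budget
  `Re z^*Az − c‖z‖² ≤ Re conjForm` («costs at most `c`»), conjugated coercivity `m‖z‖² ≤ Re conjForm`;
* §2 the budget ALGEBRA: costs add (`conjLower_add`), scale (`conjLower_real_smul`), coercivity minus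
  budget (`conjCoercive_of_conjLower`), and the MONOTONE-MAJORANT clause `conjCoercive_add_of_re_nonneg`: a
  part `P` with `Re z^*Pz ≥ 0` is dropped from the coercivity side and enters ONLY through its defect —
  the mechanism behind «G̃₃(x) has the same properties as G̃₂» (B10 (CMP 102) p. 272 ∕ [II] p. 13) at the
  level of local inverses: the `x`-vertex `x·W`, `W ≥ 0`, `x ∈ [0, X]`, costs `x·c_W ≤ X·c_W`, nothing
  else, uniformly on the compact `x`-range (cell erratum E9-6);
* §3 the bound `combesThomas_of_conjCoercive` (pairing form `‖u^*x‖ ≤ e^{−κR} m⁻¹ ‖u‖‖v‖` for `Ax = v`,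
  `v` supported in `{ρ ≤ 0}`, `u` in `{R ≤ ρ}` — the tree's `combesThomas_pairwise` with its Hermitian
  coercivity step replaced by the hypothesis), invertibility from (conjugated) coercivity
  (`isUnit_of_reCoercive`, `isUnit_of_conjCoercive`), and the ENTRYWISE localisation of the inverse
  `‖A⁻¹(i,j)‖ ≤ m⁻¹ e^{−κ d(i,j)}` from conjugated coercivity along the weights `d(·, j)`
  (`norm_inv_apply_le`).

ABSOLUTE RULE.  Nothing printed is cited as a fact; no manuscript statement enters as a hypothesis;
nothing of the an2 ∕ an5 ∕ b09 ∕ r1 lineages is restated (their declarations are used BY NAME: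
`B5Prop11Lower.nsq`, `norm_star_dotProduct_le`).  The objects of [II] §2 are NOT constructed here: this is
the abstract mechanism, to be instantiated.  References (method only): J.-M. Combes, L. Thomas, Commun.
Math. Phys. 34 (1973) 251–270 [CombesThomas1973]; S. Agmon, *Lectures on exponential decay of solutions
of second-order elliptic equations* (Princeton 1982).  NOT summit progress.
-/

open scoped BigOperators Matrix ComplexConjugate
open Finset Complex Matrix

namespace Summit.QuantumFields.BalabanUV.Beta.AccretiveCombesThomas

open Literature.MathematicalPhysics.QuantumFieldTheory.Balaban1983to89.B5Prop11Lower (nsq nsq_nonneg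
  norm_star_dotProduct_le)

noncomputable section

variable {ι : Type*} [Fintype ι]

/-! ## §1 The conjugated form and the three predicates -/

/-- The CONJUGATED sesquilinear form `Σ_{e,e′} z̄_e e^{κ(ρ_e − ρ_{e′})} A(e,e′) z_{e′}` — the quadratic form of
`E_ρ A E_ρ⁻¹`, `E_ρ = diag(e^{κρ})`, at `z`. [folklore] -/
def conjForm (A : Matrix ι ι ℂ) (κ : ℝ) (ρ : ι → ℝ) (z : ι → ℂ) : ℂ :=
  ∑ e, ∑ e', (starRingEnd ℂ) (z e) * ((Real.exp (κ * (ρ e - ρ e')) : ℝ) : ℂ) * A e e' * z e'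

/-- The unweighted form as a double sum: `z^*Az = Σ_{e,e′} z̄_e A(e,e′) z_{e′}`. [folklore] -/
theorem star_dotProduct_mulVec_eq (A : Matrix ι ι ℂ) (z : ι → ℂ) :
    star z ⬝ᵥ (A *ᵥ z) = ∑ e, ∑ e', (starRingEnd ℂ) (z e) * A e e' * z e' := by
  rw [dotProduct]
  refine Finset.sum_congr rfl fun e _ => ?_
  rw [Matrix.mulVec, dotProduct, Finset.mul_sum, Pi.star_apply, Complex.star_def]
  refine Finset.sum_congr rfl fun e' _ => ?_
  ring

/-- At rate `κ = 0` the conjugated form is the form itself. [folklore] -/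
theorem conjForm_zero_rate (A : Matrix ι ι ℂ) (ρ : ι → ℝ) (z : ι → ℂ) :
    conjForm A 0 ρ z = star z ⬝ᵥ (A *ᵥ z) := by
  rw [star_dotProduct_mulVec_eq, conjForm]
  refine Finset.sum_congr rfl fun e _ => Finset.sum_congr rfl fun e' _ => ?_
  simp

/-- Additivity in the kernel. [folklore] -/
theorem conjForm_add (A B : Matrix ι ι ℂ) (κ : ℝ) (ρ : ι → ℝ) (z : ι → ℂ) :
    conjForm (A + B) κ ρ z = conjForm A κ ρ z + conjForm B κ ρ z := by
  simp only [conjForm, Matrix.add_apply, ← Finset.sum_add_distrib]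
  refine Finset.sum_congr rfl fun e _ => Finset.sum_congr rfl fun e' _ => ?_
  ring

/-- Homogeneity in the kernel. [folklore] -/
theorem conjForm_smul (c : ℂ) (A : Matrix ι ι ℂ) (κ : ℝ) (ρ : ι → ℝ) (z : ι → ℂ) :
    conjForm (c • A) κ ρ z = c * conjForm A κ ρ z := by
  simp only [conjForm, Matrix.smul_apply, smul_eq_mul, Finset.mul_sum]
  refine Finset.sum_congr rfl fun e _ => Finset.sum_congr rfl fun e' _ => ?_
  ring

/-- Shift invariance: adding a constant to the weight does not change the conjugated form. [folklore] -/
theorem conjForm_add_const (A : Matrix ι ι ℂ) (κ : ℝ) (ρ : ι → ℝ) (c : ℝ) (z : ι → ℂ) :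
    conjForm A κ (fun e => ρ e + c) z = conjForm A κ ρ z := by
  unfold conjForm
  refine Finset.sum_congr rfl fun e _ => Finset.sum_congr rfl fun e' _ => ?_
  rw [show κ * (ρ e + c - (ρ e' + c)) = κ * (ρ e - ρ e') by ring]

/-- The conjugated form at the WEIGHTED vector `z = E_ρ x`, `z_e = e^{κρ_e} x_e`, is the pairing of `z` with the
weighted image `e ↦ e^{κρ_e}(Ax)_e` (the identity `E A E⁻¹ (E x) = E (A x)` in coordinates). [folklore] -/
theorem conjForm_weighted (A : Matrix ι ι ℂ) (κ : ℝ) (ρ : ι → ℝ) (x : ι → ℂ) :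
    conjForm A κ ρ (fun e => ((Real.exp (κ * ρ e) : ℝ) : ℂ) * x e)
      = star (fun e => ((Real.exp (κ * ρ e) : ℝ) : ℂ) * x e)
          ⬝ᵥ (fun e => ((Real.exp (κ * ρ e) : ℝ) : ℂ) * (A *ᵥ x) e) := by
  rw [conjForm, dotProduct]
  refine Finset.sum_congr rfl fun e _ => ?_
  rw [Pi.star_apply, Complex.star_def, Matrix.mulVec, dotProduct, Finset.mul_sum, Finset.mul_sum]
  refine Finset.sum_congr rfl fun e' _ => ?_
  rw [show κ * (ρ e - ρ e') = κ * ρ e - κ * ρ e' by ring, Real.exp_sub]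
  have hpos : (((Real.exp (κ * ρ e')) : ℝ) : ℂ) ≠ 0 := by exact_mod_cast (Real.exp_pos _).ne'
  push_cast
  field_simp

/-! ## §2 The defect-budget algebra (the bounds themselves: `AccretiveCombesThomasBudget`) -/

/-! Terminology used in the docstrings (hypothesis SHAPES, written out in every statement; no `Prop`-valued
definitions): «`A` is `Re`-coercive with `γ`» = `∀ z, γ‖z‖² ≤ Re z^*Az`; «conjugation of `A` at `(κ, ρ)` costs at most
`c`» = `∀ z, Re z^*Az − c‖z‖² ≤ Re conjForm A κ ρ z`; «`A` is conjugated-coercive with `m`» =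
`∀ z, m‖z‖² ≤ Re conjForm A κ ρ z`. -/

/-- Budget additivity: conjugation costs add. [folklore] -/
theorem conjLower_add {A B : Matrix ι ι ℂ} {κ : ℝ} {ρ : ι → ℝ} {c₁ c₂ : ℝ}
    (hA : ∀ z : ι → ℂ, (star z ⬝ᵥ (A *ᵥ z)).re - c₁ * nsq z ≤ (conjForm A κ ρ z).re)
    (hB : ∀ z : ι → ℂ, (star z ⬝ᵥ (B *ᵥ z)).re - c₂ * nsq z ≤ (conjForm B κ ρ z).re) (z : ι → ℂ) :
    (star z ⬝ᵥ ((A + B) *ᵥ z)).re - (c₁ + c₂) * nsq z ≤ (conjForm (A + B) κ ρ z).re := by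
  have h₁ := hA z
  have h₂ := hB z
  rw [conjForm_add, Complex.add_re, Matrix.add_mulVec, dotProduct_add, Complex.add_re]
  linarith

/-- A larger budget is still a budget. [folklore] -/
theorem conjLower_mono {A : Matrix ι ι ℂ} {κ : ℝ} {ρ : ι → ℝ} {c c' : ℝ}
    (hA : ∀ z : ι → ℂ, (star z ⬝ᵥ (A *ᵥ z)).re - c * nsq z ≤ (conjForm A κ ρ z).re) (h : c ≤ c') (z : ι → ℂ) :
    (star z ⬝ᵥ (A *ᵥ z)).re - c' * nsq z ≤ (conjForm A κ ρ z).re := by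
  have := hA z
  nlinarith [nsq_nonneg z]

/-- Budget homogeneity under a nonnegative real scalar: `x·A` costs `x·c`. [folklore] -/
theorem conjLower_real_smul {A : Matrix ι ι ℂ} {κ : ℝ} {ρ : ι → ℝ} {c : ℝ}
    (hA : ∀ z : ι → ℂ, (star z ⬝ᵥ (A *ᵥ z)).re - c * nsq z ≤ (conjForm A κ ρ z).re) {x : ℝ} (hx : 0 ≤ x)
    (z : ι → ℂ) :
    (star z ⬝ᵥ (((x : ℂ) • A) *ᵥ z)).re - x * c * nsq z ≤ (conjForm ((x : ℂ) • A) κ ρ z).re := by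
  have h := mul_le_mul_of_nonneg_left (hA z) hx
  rw [conjForm_smul, Matrix.smul_mulVec, dotProduct_smul, smul_eq_mul, Complex.re_ofReal_mul,
    Complex.re_ofReal_mul]
  nlinarith

/-- `Re`-coercivity passes to `A + P` when `Re z^*Pz ≥ 0` (monotonicity). [folklore] -/
theorem reCoercive_add_of_re_nonneg {A P : Matrix ι ι ℂ} {γ : ℝ}
    (hA : ∀ z : ι → ℂ, γ * nsq z ≤ (star z ⬝ᵥ (A *ᵥ z)).re)
    (hP : ∀ z : ι → ℂ, 0 ≤ (star z ⬝ᵥ (P *ᵥ z)).re) (z : ι → ℂ) : γ * nsq z ≤ (star z ⬝ᵥ ((A + P) *ᵥ z)).re := by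
  have h₁ := hA z
  have h₂ := hP z
  rw [Matrix.add_mulVec, dotProduct_add, Complex.add_re]
  linarith

/-- **Coercivity minus budget**: a `Re`-coercive kernel (`γ`) whose conjugation costs at most `c` is conjugated-coercive
with constant `γ − c`. [folklore] -/
theorem conjCoercive_of_conjLower {A : Matrix ι ι ℂ} {κ : ℝ} {ρ : ι → ℝ} {γ c : ℝ}
    (hγ : ∀ z : ι → ℂ, γ * nsq z ≤ (star z ⬝ᵥ (A *ᵥ z)).re)
    (hc : ∀ z : ι → ℂ, (star z ⬝ᵥ (A *ᵥ z)).re - c * nsq z ≤ (conjForm A κ ρ z).re) (z : ι → ℂ) :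
    (γ - c) * nsq z ≤ (conjForm A κ ρ z).re := by
  have h₁ := hγ z
  have h₂ := hc z
  nlinarith

/-- **The monotone-majorant clause**: if `A` is `Re`-coercive with `γ` and costs `c`, and `P` has NONNEGATIVE real
form and costs `c′`, then `A + P` is conjugated-coercive with `γ − c − c′` — the positive part is dropped from the
coercivity side and enters ONLY through its defect (e.g. the `x`-vertex `x·W`, `W ≥ 0`, `x ∈ [0, X]`: cost
`x·c_W ≤ X·c_W` by `conjLower_real_smul` + `conjLower_mono`, uniformly on the compact `x`-range). [folklore] -/
theorem conjCoercive_add_of_re_nonneg {A P : Matrix ι ι ℂ} {κ : ℝ} {ρ : ι → ℝ} {γ c c' : ℝ}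
    (hγ : ∀ z : ι → ℂ, γ * nsq z ≤ (star z ⬝ᵥ (A *ᵥ z)).re)
    (hA : ∀ z : ι → ℂ, (star z ⬝ᵥ (A *ᵥ z)).re - c * nsq z ≤ (conjForm A κ ρ z).re)
    (hP : ∀ z : ι → ℂ, 0 ≤ (star z ⬝ᵥ (P *ᵥ z)).re)
    (hPc : ∀ z : ι → ℂ, (star z ⬝ᵥ (P *ᵥ z)).re - c' * nsq z ≤ (conjForm P κ ρ z).re) (z : ι → ℂ) :
    (γ - c - c') * nsq z ≤ (conjForm (A + P) κ ρ z).re := by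
  have h := conjCoercive_of_conjLower (reCoercive_add_of_re_nonneg hγ hP) (conjLower_add hA hPc) z
  linarith

/-! ## §3 The accretive Combes–Thomas bound and the entrywise localisation of the inverse -/

/-- **The finite Combes–Thomas bound for ACCRETIVE kernels.**  If the conjugated form of `A` at weight `(κ, ρ)`,
`κ ≥ 0`, is coercive with constant `m > 0`, `Ax = v` with `v` supported in `{ρ ≤ 0}` and `u` supported in
`{R ≤ ρ}`, then `|u^* x| ≤ e^{−κR} m⁻¹ ‖u‖ ‖v‖`.  No Hermitian hypothesis: how `m` is obtained is the budget of §2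
(`conjCoercive_of_conjLower`, `conjCoercive_add_of_re_nonneg`).  Proof = the tree's
`DeltaACombesThomas.combesThomas_pairwise` with its coercivity step replaced by the hypothesis. [folklore] -/
theorem combesThomas_of_conjCoercive (A : Matrix ι ι ℂ) (ρ : ι → ℝ) {m κ R : ℝ} (hm : 0 < m) (hκ : 0 ≤ κ)
    (hc : ∀ z : ι → ℂ, m * nsq z ≤ (conjForm A κ ρ z).re) {u v x : ι → ℂ} (hx : A *ᵥ x = v)
    (hu : ∀ e, u e ≠ 0 → R ≤ ρ e) (hv : ∀ e, v e ≠ 0 → ρ e ≤ 0) :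
    ‖star u ⬝ᵥ x‖ ≤ Real.exp (-(κ * R)) / m * (Real.sqrt (nsq u) * Real.sqrt (nsq v)) := by
  -- weighted unknown and data
  set z : ι → ℂ := fun e => ((Real.exp (κ * ρ e) : ℝ) : ℂ) * x e with hz
  set w : ι → ℂ := fun e => ((Real.exp (κ * ρ e) : ℝ) : ℂ) * v e with hw
  -- (a)+(b) the conjugated form at `z` is `z^* w`
  have hquad : conjForm A κ ρ z = star z ⬝ᵥ w := by
    rw [hz, conjForm_weighted, hx]
  -- (c) conjugated coercivity + Cauchy–Schwarz: `m‖z‖² ≤ Re z^* w ≤ ‖z‖ ‖w‖`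
  have hcoer := hc z
  rw [hquad] at hcoer
  have hCS : (star z ⬝ᵥ w).re ≤ Real.sqrt (nsq z) * Real.sqrt (nsq w) :=
    (Complex.re_le_norm _).trans (norm_star_dotProduct_le z w)
  have hZ0 : 0 ≤ Real.sqrt (nsq z) := Real.sqrt_nonneg _
  have hzle : m * Real.sqrt (nsq z) ≤ Real.sqrt (nsq w) := by
    by_cases hZ : Real.sqrt (nsq z) = 0
    · rw [hZ, mul_zero]; exact Real.sqrt_nonneg _
    · have hZpos : 0 < Real.sqrt (nsq z) := lt_of_le_of_ne hZ0 (Ne.symm hZ)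
      have key : (m * Real.sqrt (nsq z)) * Real.sqrt (nsq z) ≤ Real.sqrt (nsq w) * Real.sqrt (nsq z) := by
        calc (m * Real.sqrt (nsq z)) * Real.sqrt (nsq z) = m * (Real.sqrt (nsq z) * Real.sqrt (nsq z)) := by
              ring
          _ = m * nsq z := by rw [Real.mul_self_sqrt (nsq_nonneg _)]
          _ ≤ Real.sqrt (nsq z) * Real.sqrt (nsq w) := hcoer.trans hCS
          _ = Real.sqrt (nsq w) * Real.sqrt (nsq z) := mul_comm _ _
      exact le_of_mul_le_mul_right key hZpos
  -- (d) the data weight is `≤ 1` on the support of `v`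
  have hwv : nsq w ≤ nsq v := by
    unfold nsq
    refine Finset.sum_le_sum fun e _ => ?_
    simp only [hw]
    by_cases hve : v e = 0
    · simp [hve]
    · have hexp1 : Real.exp (κ * ρ e) ≤ 1 := by
        rw [Real.exp_le_one_iff]; exact mul_nonpos_of_nonneg_of_nonpos hκ (hv e hve)
      have hexp0 : 0 ≤ Real.exp (κ * ρ e) := (Real.exp_pos _).le
      rw [norm_mul, Complex.norm_real, Real.norm_of_nonneg hexp0, mul_pow]
      calc Real.exp (κ * ρ e) ^ 2 * ‖v e‖ ^ 2 ≤ 1 ^ 2 * ‖v e‖ ^ 2 := by gcongr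
        _ = ‖v e‖ ^ 2 := by ring
  -- (e) the observable weight is `≤ e^{−κR}` on the support of `u`
  set u' : ι → ℂ := fun e => ((Real.exp (-(κ * ρ e)) : ℝ) : ℂ) * u e with hu'
  have hux : star u ⬝ᵥ x = star u' ⬝ᵥ z := by
    rw [dotProduct, dotProduct]
    refine Finset.sum_congr rfl fun e _ => ?_
    simp only [hz, hu', Pi.star_apply, Complex.star_def, map_mul, Complex.conj_ofReal]
    rw [Real.exp_neg]
    have hpos : (((Real.exp (κ * ρ e)) : ℝ) : ℂ) ≠ 0 := by exact_mod_cast (Real.exp_pos _).ne'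
    push_cast
    field_simp
  have hu'le : nsq u' ≤ Real.exp (-(κ * R)) ^ 2 * nsq u := by
    unfold nsq
    rw [Finset.mul_sum]
    refine Finset.sum_le_sum fun e _ => ?_
    simp only [hu']
    by_cases hue : u e = 0
    · simp [hue]
    · have hexp : Real.exp (-(κ * ρ e)) ≤ Real.exp (-(κ * R)) := by
        rw [Real.exp_le_exp]
        have := hu e hue
        nlinarith
      have hexp0 : 0 ≤ Real.exp (-(κ * ρ e)) := (Real.exp_pos _).le
      rw [norm_mul, Complex.norm_real, Real.norm_of_nonneg hexp0, mul_pow]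
      gcongr
  -- (f) assemble
  have hE0 : 0 ≤ Real.exp (-(κ * R)) := (Real.exp_pos _).le
  calc ‖star u ⬝ᵥ x‖ = ‖star u' ⬝ᵥ z‖ := by rw [hux]
    _ ≤ Real.sqrt (nsq u') * Real.sqrt (nsq z) := norm_star_dotProduct_le u' z
    _ ≤ (Real.exp (-(κ * R)) * Real.sqrt (nsq u)) * (Real.sqrt (nsq w) / m) := by
        have h1 : Real.sqrt (nsq u') ≤ Real.exp (-(κ * R)) * Real.sqrt (nsq u) := by
          calc Real.sqrt (nsq u') ≤ Real.sqrt (Real.exp (-(κ * R)) ^ 2 * nsq u) := Real.sqrt_le_sqrt hu'le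
            _ = Real.exp (-(κ * R)) * Real.sqrt (nsq u) := by
                rw [Real.sqrt_mul (sq_nonneg _), Real.sqrt_sq hE0]
        have h2 : Real.sqrt (nsq z) ≤ Real.sqrt (nsq w) / m := by
          rw [le_div_iff₀ hm, mul_comm]; exact hzle
        gcongr
    _ ≤ (Real.exp (-(κ * R)) * Real.sqrt (nsq u)) * (Real.sqrt (nsq v) / m) := by
        gcongr
    _ = Real.exp (-(κ * R)) / m * (Real.sqrt (nsq u) * Real.sqrt (nsq v)) := by
        field_simp

/-- **Invertibility from accretivity**: a `Re`-coercive kernel with `γ > 0` is invertible (injective `mulVec`).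
[folklore] -/
theorem isUnit_of_reCoercive [DecidableEq ι] {A : Matrix ι ι ℂ} {γ : ℝ} (hγ : 0 < γ)
    (h : ∀ z : ι → ℂ, γ * nsq z ≤ (star z ⬝ᵥ (A *ᵥ z)).re) : IsUnit A := by
  rw [← Matrix.mulVec_injective_iff_isUnit]
  intro x y hxy
  have h0 : A *ᵥ (x - y) = 0 := by rw [Matrix.mulVec_sub, hxy, sub_self]
  have hle := h (x - y)
  rw [h0, dotProduct_zero, Complex.zero_re] at hle
  have hn : nsq (x - y) ≤ 0 := by nlinarith [nsq_nonneg (x - y)]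
  have hz : ∀ e, (x - y) e = 0 := by
    intro e
    have hsum : ∑ i, ‖(x - y) i‖ ^ 2 = 0 := le_antisymm hn (nsq_nonneg _)
    have := (Finset.sum_eq_zero_iff_of_nonneg (fun i _ => sq_nonneg ‖(x - y) i‖)).1 hsum e (Finset.mem_univ e)
    simpa using this
  funext e
  exact sub_eq_zero.1 (hz e)

/-- Conjugated coercivity at rate `κ` with `m > 0` also gives invertibility (apply `E_ρ`: `Ax = 0` forces the
conjugated form at `E_ρx` to vanish). [folklore] -/
theorem isUnit_of_conjCoercive [DecidableEq ι] {A : Matrix ι ι ℂ} {κ m : ℝ} {ρ : ι → ℝ} (hm : 0 < m)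
    (h : ∀ z : ι → ℂ, m * nsq z ≤ (conjForm A κ ρ z).re) : IsUnit A := by
  rw [← Matrix.mulVec_injective_iff_isUnit]
  intro x y hxy
  have h0 : A *ᵥ (x - y) = 0 := by rw [Matrix.mulVec_sub, hxy, sub_self]
  set z : ι → ℂ := fun e => ((Real.exp (κ * ρ e) : ℝ) : ℂ) * (x - y) e with hz
  have hq : conjForm A κ ρ z = 0 := by
    rw [hz, conjForm_weighted, h0]
    simp [dotProduct]
  have hle := h z
  rw [hq, Complex.zero_re] at hle
  have hn : nsq z ≤ 0 := by nlinarith [nsq_nonneg z]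
  have hsum : ∑ i, ‖z i‖ ^ 2 = 0 := le_antisymm hn (nsq_nonneg _)
  funext e
  have := (Finset.sum_eq_zero_iff_of_nonneg (fun i _ => sq_nonneg ‖z i‖)).1 hsum e (Finset.mem_univ e)
  have hze : z e = 0 := by simpa using this
  have hexp : (((Real.exp (κ * ρ e)) : ℝ) : ℂ) ≠ 0 := by exact_mod_cast (Real.exp_pos _).ne'
  have : (x - y) e = 0 := by
    simp only [hz, mul_eq_zero] at hze
    exact hze.resolve_left hexp
  exact sub_eq_zero.1 (by simpa using this)

/-- `‖e_i‖ = 1` for the coordinate vector. [folklore] -/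
theorem nsq_single [DecidableEq ι] (i : ι) : nsq (Pi.single i (1 : ℂ)) = 1 := by
  unfold nsq
  rw [Finset.sum_eq_single i (fun j _ hj => by simp [hj]) (fun h => absurd (Finset.mem_univ i) h)]
  simp

/-- **Entrywise localisation of the inverse.**  If for every column index `j` the conjugated form of `A` along the
weight `ρ = d(·, j)` (rate `κ ≥ 0`) is coercive with the SAME constant `m > 0`, and `d(j,j) = 0`, then
`‖A⁻¹(i,j)‖ ≤ m⁻¹ e^{−κ d(i,j)}` for all `i, j`.  (The defect hypotheses of §2 are sign- and shift-symmetric, so in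
practice they are verified once for all `d`-Lipschitz weights.) [folklore] -/
theorem norm_inv_apply_le [DecidableEq ι] (A : Matrix ι ι ℂ) (d : ι → ι → ℝ) (hd0 : ∀ j, d j j = 0) {κ m : ℝ}
    (hκ : 0 ≤ κ) (hm : 0 < m) (hc : ∀ j, ∀ z : ι → ℂ, m * nsq z ≤ (conjForm A κ (fun e => d e j) z).re)
    (i j : ι) :
    ‖A⁻¹ i j‖ ≤ Real.exp (-(κ * d i j)) / m := by
  have hAu : IsUnit A := isUnit_of_conjCoercive hm (hc j)
  have hdet : IsUnit A.det := (Matrix.isUnit_iff_isUnit_det A).mp hAu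
  -- x = A⁻¹ e_j solves A x = e_j
  have hx : A *ᵥ (A⁻¹ *ᵥ Pi.single j 1) = Pi.single j 1 := by
    rw [Matrix.mulVec_mulVec, Matrix.mul_nonsing_inv A hdet, Matrix.one_mulVec]
  have h := combesThomas_of_conjCoercive A (fun e => d e j) hm hκ (hc j) (R := d i j)
    (u := Pi.single i 1) hx
    (fun e he => by
      by_cases hei : e = i
      · subst hei; exact le_rfl
      · exact absurd (by simp [hei]) he)
    (fun e he => by
      by_cases hej : e = j
      · subst hej; exact (hd0 e).le
      · exact absurd (by simp [hej]) he)
  have hentry : star (Pi.single i (1 : ℂ)) ⬝ᵥ (A⁻¹ *ᵥ Pi.single j 1) = A⁻¹ i j := by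
    rw [dotProduct, Finset.sum_eq_single i (fun e _ he => by simp [he])
      (fun h => absurd (Finset.mem_univ i) h)]
    simp [Matrix.mulVec, dotProduct, Pi.single_apply]
  rw [hentry, nsq_single, nsq_single, Real.sqrt_one, mul_one, mul_one] at h
  exact h

end

end Summit.QuantumFields.BalabanUV.Beta.AccretiveCombesThomas
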